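import Summits.Ventures.PercRepro.Night2NonFatSmall
import Summits.Ventures.PercRepro.Night2FatDDAll
import Summits.Ventures.PercRepro.Night2TwoOneFreeCell

/-!
# night-2: h21's cell `(2, 1)` at `|G| = 10` is closed (gen 37)

The three sub-cases of h21's cell by the number of fat closures: at least two (`localShadowHall_two_one_five_fatClosures_free`,
gen 28), exactly one (`localShadowHall_fat`, gen 36), none (`localShadowHall_nonfat_of_card_eq_ten`, this gen, at `|G| = 10`).
So **`localShadowHall_two_one_of_card_eq_ten`**: every rank-`6` flat `G` of the cell `(2, 1)` with ten points satisfies the local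
Hall inequality — the first size of the cell not covered by `localShadowHall_of_small` (`|G ∖ K| ≤ 8`).
Paper: proofs/NIGHT-2-g37.md §3.
-/

namespace PercRepro.Shadow

open PercRepro.ThmH PercRepro.PerFlat

variable {α : Type*} [DecidableEq α] {M : Matroid α} [M.Finite] {G : Finset α}

/-- **Exactly one fat closure**: a thin member `B₀` with `|G ∖ clF B₀| = 2`. -/
theorem exists_fat_member_of_card_eq_one (hG : G ∈ flatsQ M (5 + 1)) (hd : (gr M \ G).card = 2)
    (h1 : (fatClosures M 5 G 2).card = 1) :
    ∃ B₀ ∈ thinMembers M 5 G, (G \ clF M B₀).card = 2 := by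
  obtain ⟨H₀, hH₀⟩ := Finset.card_eq_one.1 h1
  have hmem : H₀ ∈ fatClosures M 5 G 2 := by
    rw [hH₀]
    exact Finset.mem_singleton_self _
  unfold fatClosures at hmem
  obtain ⟨B₀, hB₀, -⟩ := Finset.mem_image.1 hmem
  rw [Finset.mem_filter] at hB₀
  refine ⟨B₀, hB₀.1, ?_⟩
  have hd' : (gr M \ G).card ≤ 5 := by omega
  have h2 := two_le_card_sdiff_of_not_lay0 hG hd' (mem_thinMembers.1 hB₀.1).1 (mem_thinMembers.1 hB₀.1).2
  omega

/-- **h21's cell `(2, 1)` at `|G| = 10`.** -/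
theorem localShadowHall_two_one_of_card_eq_ten (hG : G ∈ flatsQ M (5 + 1)) (hd : (gr M \ G).card = 2)
    (hk : kColoops M G = 1) (hs : ∀ e ∈ gr M, ∀ f ∈ gr M, e ≠ f → rkN M {e, f} = 2)
    (hl : ∀ e ∈ gr M, M.Indep {e}) (h10 : G.card = 10) : LocalShadowHall M 5 G := by
  rcases Nat.lt_or_ge (fatClosures M 5 G 2).card 2 with hlt | hge
  · rcases Nat.lt_or_ge (fatClosures M 5 G 2).card 1 with h0 | h1
    · have hnf : fatClosures M 5 G 2 = ∅ := Finset.card_eq_zero.1 (by omega)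
      exact localShadowHall_nonfat_of_card_eq_ten hG hd hk hs hl hnf h10
    · obtain ⟨B₀, hB₀, hm₀⟩ := exists_fat_member_of_card_eq_one hG hd (by omega)
      exact localShadowHall_fat hG hd hk hs hl (by omega) hB₀ hm₀
  · exact localShadowHall_two_one_five_fatClosures_free hG hd hk hs hl hge

end PercRepro.Shadow
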